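import Mathlib
import Summits.ValiantsHypothesis.ValiantsHypothesis.Theorems.NewtonUnitEquationsTwoProductsFormalLogLinearisationDefs
import Summits.ValiantsHypothesis.ValiantsHypothesis.Theorems.NewtonUnitEquationsTwoProductsCommonCone
import Summits.ValiantsHypothesis.ValiantsHypothesis.Theorems.NewtonUnitEquationsTwoProductsFormalLogLinearisationEngineCommonConeLattice
import HarnessLib

/-!
# Route NewtonUnitEquations — crux `TwoProducts` (stmt-ValiantsHypothesis-5906), line `formal-log-linearisation`:
# the COMMON TWO-MONOMIAL TAIL CONE rung of the engine (`EngineCommonConeRung`)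

Registered line `Cruxes/TwoProducts/Lines/formal-log-linearisation.lean` (NOT the item's skeleton of record;
helper mode, no stub credit claimed). The line types, next to its open engine `stub_logSumEngine`, ONE rung of the
engine "already known on paper" as a `--supports` sub-target (its § "A rung of the engine already known on paper",
`EngineCommonConeRung`, NOT a stub). This file proves it VERBATIM over the line's vocabulary
(`Theorems/NewtonUnitEquationsTwoProductsFormalLogLinearisationDefs.lean`: `logCoeff`, `logDiff`, `logSupport`,
`logVisible`, `ValidWeight`, `IsStrictTop`, `wt`):

* `engineCommonConeRung` — if all `2m` tails `u j`, `v j` have zero constant term and support inside `{e₁, e₂}`,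
  then any finite set of visible points of the support of `D = Σ_j log(1 + u_j) − Σ_j log(1 + v_j)` has at most
  `2m` elements.

Proof. INDEPENDENT exponents (`e₁ 0 * e₂ 1 ≠ e₁ 1 * e₂ 0`): `(p, q) ↦ p•e₁ + q•e₂` is injective, the coefficient
of `X^{p•e₁+q•e₂}` in `(a X^{e₁} + b X^{e₂})^r` is `[p+q = r]·C(r,p) a^p b^q` (the record line's landed
`CommonCone.coeff_pow_smul_add_smul`), so `[D]_{p•e₁+q•e₂} = κ_{pq} · G(p,q)` with `κ_{pq} = (−1)^{p+q+1} C(p+q,p)/(p+q)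
≠ 0` and `G(p,q) = Σ_j a_j^p b_j^q − Σ_j a'_j^p b'_j^q`, a pattern of rank `≤ 2m` (`logDiff_lattice`); a visible
point is `p•e₁ + q•e₂` for a MINIMAL nonzero `(p, q)` of `G` in the componentwise order (`minimal_of_logVisible`: a
smaller nonzero would be a support point of larger weight, the weights of the exponents that occur being negative
for every valid weight), and minimal nonzeros of a rank-`≤ 2m` pattern number at most `2m` (the landed rank
obstruction `CommonCone.card_le_of_minimal_nonzeros` / `Negative.card_corners_le_rank`). DEPENDENT exponents: the
whole support of `D` lies on one ray through a tail exponent `ρ`, along which every valid weight is strictly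
monotone (`wt ξ n · |ρ| = |n| · wt ξ ρ`), so at most ONE point is ever visible (`card_le_one_of_dependent`).

Honest framing: a calibration rung of the line's OPEN engine (the common-cone sub-regime, in the line's own
currency; the record skeleton's `stub_engineCommonCone` is the same mathematics in the truncated-series currency);
the engine `stub_logSumEngine` and the crux `TwoProducts` stay OPEN, and nothing here is progress on `VP ≠ VNP`
(NOT proved). No definitions, no named facts. The independent-exponent half (coefficient formula, minimality of
visible points, rank count) is the companion
`Theorems/NewtonUnitEquationsTwoProductsFormalLogLinearisationEngineCommonConeLattice.lean`; this file does the
DEPENDENT half (one ray) and assembles the rung.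
-/

noncomputable section

-- Sub = Summit single-conjunct layout: the duplicated namespace component is mandated by the tree.
set_option linter.dupNamespace false

namespace Summit.ValiantsHypothesis.ValiantsHypothesis.Theorems.NewtonUnitEquations.TwoProducts.FormalLogLinearisation

open MvPolynomial
open Summit.ValiantsHypothesis.ValiantsHypothesis.Theorems.TwoProducts
open scoped BigOperators

variable {m : ℕ}

/-! ### Dependent exponents: one ray, at most one visible point -/

/-- Along a ray the weight is proportional to the coordinate sum: if `n` is parallel to `ρ` then
`wt ξ n · (ρ₀ + ρ₁) = (n₀ + n₁) · wt ξ ρ`. [folklore] -/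
theorem wt_mul_coordSum_of_parallel (ξ : Fin 2 → ℝ) {n ρ : Expo} (hpar : n 0 * ρ 1 = n 1 * ρ 0) :
    wt ξ n * (((ρ 0 : ℕ) : ℝ) + ((ρ 1 : ℕ) : ℝ)) = (((n 0 : ℕ) : ℝ) + ((n 1 : ℕ) : ℝ)) * wt ξ ρ := by
  have h : ((n 0 : ℕ) : ℝ) * ((ρ 1 : ℕ) : ℝ) = ((n 1 : ℕ) : ℝ) * ((ρ 0 : ℕ) : ℝ) := by exact_mod_cast hpar
  simp only [wt]
  linear_combination (ξ 0 - ξ 1) * h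

/-- Two parallel points of a ray with the same coordinate sum coincide. [folklore] -/
theorem eq_of_parallel_of_coordSum_eq {n n' ρ : Expo} (hρ : ρ ≠ 0) (hn : n 0 * ρ 1 = n 1 * ρ 0)
    (hn' : n' 0 * ρ 1 = n' 1 * ρ 0) (hsum : n 0 + n 1 = n' 0 + n' 1) : n = n' := by
  have hρs : 0 < ρ 0 + ρ 1 := one_le_coordSum hρ
  have e0 : n 0 * (ρ 0 + ρ 1) = (n 0 + n 1) * ρ 0 := by
    rw [Nat.mul_add, Nat.add_mul, hn]
  have e0' : n' 0 * (ρ 0 + ρ 1) = (n' 0 + n' 1) * ρ 0 := by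
    rw [Nat.mul_add, Nat.add_mul, hn']
  have e1 : n 1 * (ρ 0 + ρ 1) = (n 0 + n 1) * ρ 1 := by
    rw [Nat.mul_add, Nat.add_mul, ← hn]
  have e1' : n' 1 * (ρ 0 + ρ 1) = (n' 0 + n' 1) * ρ 1 := by
    rw [Nat.mul_add, Nat.add_mul, ← hn']
  have h0 : n 0 = n' 0 := Nat.eq_of_mul_eq_mul_right hρs (by rw [e0, e0', hsum])
  have h1 : n 1 = n' 1 := Nat.eq_of_mul_eq_mul_right hρs (by rw [e1, e1', hsum])
  ext i
  fin_cases i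
  · exact h0
  · exact h1

/-- Lattice points of two exponents parallel to `ρ` are parallel to `ρ`. [folklore] -/
theorem parallel_lattice {e₁ e₂ ρ : Expo} (h₁ : e₁ 0 * ρ 1 = e₁ 1 * ρ 0) (h₂ : e₂ 0 * ρ 1 = e₂ 1 * ρ 0)
    (p q : ℕ) : (p • e₁ + q • e₂) 0 * ρ 1 = (p • e₁ + q • e₂) 1 * ρ 0 := by
  simp only [Finsupp.coe_add, Finsupp.coe_smul, Pi.add_apply, Pi.smul_apply, smul_eq_mul]
  calc (p * e₁ 0 + q * e₂ 0) * ρ 1 = p * (e₁ 0 * ρ 1) + q * (e₂ 0 * ρ 1) := by ring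
    _ = p * (e₁ 1 * ρ 0) + q * (e₂ 1 * ρ 0) := by rw [h₁, h₂]
    _ = (p * e₁ 1 + q * e₂ 1) * ρ 0 := by ring

/-- A support point of the log-sum sees a nonzero power of some tail, hence a tail with nonempty support.
[folklore] -/
theorem exists_mem_support_of_mem_logSupport {u v : Fin m → MvPolynomial (Fin 2) ℂ} {n : Expo}
    (hn : n ∈ logSupport u v) :
    ∃ j, (∃ r, 1 ≤ r ∧ coeff n (u j ^ r) ≠ 0) ∨ ∃ r, 1 ≤ r ∧ coeff n (v j ^ r) ≠ 0 := by
  classical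
  have hD : logDiff u v n ≠ 0 := hn
  unfold logDiff at hD
  have hor : (∑ j, logCoeff (u j) n) ≠ 0 ∨ (∑ j, logCoeff (v j) n) ≠ 0 := by
    by_contra h
    push Not at h
    exact hD (by rw [h.1, h.2, sub_zero])
  -- a nonzero summand of a nonzero `logCoeff`
  have aux : ∀ w : MvPolynomial (Fin 2) ℂ, logCoeff w n ≠ 0 → ∃ r, 1 ≤ r ∧ coeff n (w ^ r) ≠ 0 := by
    intro w hw
    unfold logCoeff at hw
    obtain ⟨r, hr, hne⟩ := Finset.exists_ne_zero_of_sum_ne_zero hw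
    exact ⟨r, (Finset.mem_Icc.1 hr).1, right_ne_zero_of_mul hne⟩
  rcases hor with h | h
  · obtain ⟨j, -, hj⟩ := Finset.exists_ne_zero_of_sum_ne_zero h
    exact ⟨j, Or.inl (aux _ hj)⟩
  · obtain ⟨j, -, hj⟩ := Finset.exists_ne_zero_of_sum_ne_zero h
    exact ⟨j, Or.inr (aux _ hj)⟩

/-- A nonzero coefficient of a positive power forces a nonempty support. [folklore] -/
theorem support_nonempty_of_coeff_pow_ne_zero {w : MvPolynomial (Fin 2) ℂ} {n : Expo} {r : ℕ} (hr : 1 ≤ r)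
    (h : coeff n (w ^ r) ≠ 0) : w.support.Nonempty := by
  rw [MvPolynomial.support_nonempty]
  rintro rfl
  rw [zero_pow (by omega), MvPolynomial.coeff_zero] at h
  exact h rfl

/-- **Dependent cone: at most one visible point.** If `e₁ 0 * e₂ 1 = e₁ 1 * e₂ 0`, all support points of `D`
lie on one ray through a tail exponent `ρ`, every valid weight is negative at `ρ` and hence strictly decreasing
in the coordinate sum along the ray, so two distinct support points are never both visible. [folklore] -/
theorem card_le_one_of_dependent {e₁ e₂ : Expo} (hdep : e₁ 0 * e₂ 1 = e₁ 1 * e₂ 0)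
    {u v : Fin m → MvPolynomial (Fin 2) ℂ} {a b a' b' : Fin m → ℂ}
    (hu : ∀ j, u j = monomial e₁ (a j) + monomial e₂ (b j))
    (hv : ∀ j, v j = monomial e₁ (a' j) + monomial e₂ (b' j))
    (hsu : ∀ j, (u j).support ⊆ {e₁, e₂}) (hsv : ∀ j, (v j).support ⊆ {e₁, e₂})
    (hu0 : ∀ j, coeff 0 (u j) = 0) (hv0 : ∀ j, coeff 0 (v j) = 0)
    (S : Finset Expo) (hS : ↑S ⊆ logVisible u v) : S.card ≤ 1 := by
  classical
  refine Finset.card_le_one.2 fun l hl l' hl' => ?_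
  obtain ⟨ξ, hvalid, hmem, htop⟩ := hS (Finset.mem_coe.2 hl)
  obtain ⟨ξ', hvalid', hmem', htop'⟩ := hS (Finset.mem_coe.2 hl')
  -- a tail exponent `ρ ∈ {e₁, e₂}` that occurs, with negative weight for every valid weight
  obtain ⟨ρ, hρ12, hρ0, hρneg, hρneg'⟩ : ∃ ρ : Expo, (ρ = e₁ ∨ ρ = e₂) ∧ ρ ≠ 0 ∧ wt ξ ρ < 0 ∧ wt ξ' ρ < 0 := by
    obtain ⟨j, ⟨r, hr, hc⟩ | ⟨r, hr, hc⟩⟩ := exists_mem_support_of_mem_logSupport hmem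
    · obtain ⟨ρ, hρ⟩ := support_nonempty_of_coeff_pow_ne_zero hr hc
      have hρ12 : ρ = e₁ ∨ ρ = e₂ := by simpa using hsu j hρ
      have hρ0 : ρ ≠ 0 := by
        rintro rfl
        exact (MvPolynomial.mem_support_iff.1 hρ) (hu0 j)
      exact ⟨ρ, hρ12, hρ0, hvalid.1 j ρ hρ, hvalid'.1 j ρ hρ⟩
    · obtain ⟨ρ, hρ⟩ := support_nonempty_of_coeff_pow_ne_zero hr hc
      have hρ12 : ρ = e₁ ∨ ρ = e₂ := by simpa using hsv j hρ
      have hρ0 : ρ ≠ 0 := by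
        rintro rfl
        exact (MvPolynomial.mem_support_iff.1 hρ) (hv0 j)
      exact ⟨ρ, hρ12, hρ0, hvalid.2 j ρ hρ, hvalid'.2 j ρ hρ⟩
  -- both exponents are parallel to `ρ`
  have hpar₁ : e₁ 0 * ρ 1 = e₁ 1 * ρ 0 := by
    rcases hρ12 with h | h
    · rw [h]; exact Nat.mul_comm _ _
    · rw [h]; exact hdep
  have hpar₂ : e₂ 0 * ρ 1 = e₂ 1 * ρ 0 := by
    rcases hρ12 with h | h
    · rw [h]
      calc e₂ 0 * e₁ 1 = e₁ 1 * e₂ 0 := Nat.mul_comm _ _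
        _ = e₁ 0 * e₂ 1 := hdep.symm
        _ = e₂ 1 * e₁ 0 := Nat.mul_comm _ _
    · rw [h]; exact Nat.mul_comm _ _
  -- hence so are `l` and `l'`
  obtain ⟨p, q, rfl⟩ := exists_lattice_of_mem_logSupport hu hv hmem
  obtain ⟨p', q', rfl⟩ := exists_lattice_of_mem_logSupport hu hv hmem'
  have hl_par := parallel_lattice hpar₁ hpar₂ p q
  have hl'_par := parallel_lattice hpar₁ hpar₂ p' q'
  by_contra hne
  have hρs : (0 : ℝ) < ((ρ 0 : ℕ) : ℝ) + ((ρ 1 : ℕ) : ℝ) := by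
    have := one_le_coordSum hρ0
    exact_mod_cast this
  -- the coordinate sums differ; the smaller one weighs more for both weights
  rcases Nat.lt_trichotomy ((p • e₁ + q • e₂) 0 + (p • e₁ + q • e₂) 1)
      ((p' • e₁ + q' • e₂) 0 + (p' • e₁ + q' • e₂) 1) with hlt | heq | hgt
  · -- `l` weighs more than `l'` for `ξ'`, contradicting the strict top `l'`
    have h1 := htop' _ hmem hne
    have e := wt_mul_coordSum_of_parallel ξ' hl_par
    have e' := wt_mul_coordSum_of_parallel ξ' hl'_par
    have hlt' : (((p • e₁ + q • e₂) 0 : ℕ) : ℝ) + (((p • e₁ + q • e₂) 1 : ℕ) : ℝ) <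
        (((p' • e₁ + q' • e₂) 0 : ℕ) : ℝ) + (((p' • e₁ + q' • e₂) 1 : ℕ) : ℝ) := by exact_mod_cast hlt
    nlinarith
  · exact hne (eq_of_parallel_of_coordSum_eq hρ0 hl_par hl'_par heq)
  · have h1 := htop _ hmem' (Ne.symm hne)
    have e := wt_mul_coordSum_of_parallel ξ hl_par
    have e' := wt_mul_coordSum_of_parallel ξ hl'_par
    have hgt' : (((p' • e₁ + q' • e₂) 0 : ℕ) : ℝ) + (((p' • e₁ + q' • e₂) 1 : ℕ) : ℝ) <
        (((p • e₁ + q • e₂) 0 : ℕ) : ℝ) + (((p • e₁ + q • e₂) 1 : ℕ) : ℝ) := by exact_mod_cast hgt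
    nlinarith

/-! ### The rung -/

/-- **`EngineCommonConeRung` of the line `formal-log-linearisation`, verbatim** (the common two-monomial tail cone
rung of the engine, Disproof F4 / card (iii)): if all `2m` tails have zero constant term and support inside
`{e₁, e₂}`, then any finite set of visible points of `supp D`, `D = Σ_j log(1 + u_j) − Σ_j log(1 + v_j)`, has at
most `2m` elements — independent exponents: minimal nonzeros of the rank-`≤ 2m` pattern `G(p,q) = Σ ± a^p b^q`
(rank obstruction, tight by `Negative.corners_rank_tight`); dependent exponents: at most one visible point.
Helper for crux `TwoProducts` (stmt-ValiantsHypothesis-5906) on a registered non-record line; the engine and the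
crux stay OPEN. [folklore] -/
theorem engineCommonConeRung :
    ∀ (m : ℕ) (e₁ e₂ : Expo) (u v : Fin m → MvPolynomial (Fin 2) ℂ),
      (∀ j, coeff 0 (u j) = 0 ∧ (u j).support ⊆ {e₁, e₂}) →
        (∀ j, coeff 0 (v j) = 0 ∧ (v j).support ⊆ {e₁, e₂}) →
          ∀ S : Finset Expo, (↑S ⊆ logVisible u v) → S.card ≤ 2 * m := by
  classical
  intro m e₁ e₂ u v hu hv S hS
  -- binomial shapes of the tails
  have ku : ∀ j, ∃ a b : ℂ, u j = monomial e₁ a + monomial e₂ b ∧ (a ≠ 0 → e₁ ∈ (u j).support) ∧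
      (b ≠ 0 → e₂ ∈ (u j).support) := fun j => exists_eq_binomial (hu j).2
  have kv : ∀ j, ∃ a b : ℂ, v j = monomial e₁ a + monomial e₂ b ∧ (a ≠ 0 → e₁ ∈ (v j).support) ∧
      (b ≠ 0 → e₂ ∈ (v j).support) := fun j => exists_eq_binomial (hv j).2
  choose a b hua hua1 hua2 using ku
  choose a' b' hva hva1 hva2 using kv
  by_cases hdet : e₁ 0 * e₂ 1 ≠ e₁ 1 * e₂ 0
  · exact card_le_of_independent hdet hua hva hua1 hua2 hva1 hva2 S hS
  · push Not at hdet
    -- dependent: at most one visible point; and none at all when `m = 0`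
    rcases S.eq_empty_or_nonempty with hS0 | ⟨l, hl⟩
    · rw [hS0, Finset.card_empty]; exact Nat.zero_le _
    · have hm : 1 ≤ m := by
        obtain ⟨ξ, -, hmem, -⟩ := hS (Finset.mem_coe.2 hl)
        obtain ⟨j, -⟩ := exists_mem_support_of_mem_logSupport hmem
        exact Nat.succ_le_of_lt (Nat.pos_of_ne_zero fun h0 => by subst h0; exact j.elim0)
      exact (card_le_one_of_dependent hdet hua hva (fun j => (hu j).2) (fun j => (hv j).2)
        (fun j => (hu j).1) (fun j => (hv j).1) S hS).trans (by omega)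


end Summit.ValiantsHypothesis.ValiantsHypothesis.Theorems.NewtonUnitEquations.TwoProducts.FormalLogLinearisation

end
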